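import Summits.Parity.GeneralizedHardyLittlewood.Theorems.FordMaynardSieveConst01651SieveConst01651BuchstabTableSound
import Summits.Parity.GeneralizedHardyLittlewood.Theorems.FordMaynardSieveConst01651SieveConst01651BuchstabCert
import HarnessLib

/-!
# Route `FordMaynardSieveConst01651`, target `SieveConst01651` (stmt-Parity-19185), stub `stub_certValuePos` (R2):
# soundness of `certU1` — the `r = 1` pairing is at most `certU1/D`

Def-free helper file.  In the cut form (`…BuchstabCuts.sieveBoundG1_coneCert_eq_cut`) the `g₁` term is
`−∫_{(ν₀,1/2]} Φ₆(1−t)/t dt = −∫_{1/2}^{1−ν₀} Φ₆(x)/(1−x) dx`.  Splitting `[1/2, 1−ν₀] = [x_{60000}, x_{100188}]` into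
grid cells and using the table enclosure `Φ₆ ≤ Φ⁺_i/D` on `(x_i, x_{i+1}]` (`…BuchstabTableSound`) and
`1/(1−x) ≤ J/(J−i−1)` there:

  `D · ∫_{(ν₀,1/2]} Φ₆(1−t)/t dt ≤ Σ_{i=60000}^{100187} ⌈Φ⁺_i/(J−i−1)⌉ = certU1`   (`pairing_one_le_certU1`).

* `u1Fold_eq` — the fold is the sum `acc + Σ_k ⌈v_k/(J−(i+k)−1)⌉`;
* `phiSix_div_intervalIntegrable`, `cell_integral_le` — one cell; `gen_integral_le` — a run of cells inside one
  generation; `tabRun_phiHi_length`.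

References: [FordMaynard2024PrimeSieves] arXiv:2407.14368, Theorem 7.3 (a), §8.2.
-/

noncomputable section

open MeasureTheory Set Finset intervalIntegral
open scoped Classical
open Literature.NumberTheory.Sieve Literature.NumberTheory.Sieve.FordMaynard
open Literature.Analysis.Convolution

namespace Summit.Parity.GeneralizedHardyLittlewood.FordMaynardSieveConst01651SieveConst01651

/-! ### The fold as a sum -/

/-- `u1Fold J i L acc = acc + Σ_{k < |L|} ⌈L_k/(J − (i+k) − 1)⌉`. [folklore] -/
theorem u1Fold_eq (J : ℕ) : ∀ (L : List ℕ) (i acc : ℕ),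
    u1Fold J i L acc = acc + ∑ k ∈ Finset.range L.length, cdiv (L.getD k 0) (J - (i + k) - 1)
  | [], i, acc => by simp [u1Fold]
  | v :: L, i, acc => by
    rw [u1Fold, u1Fold_eq J L (i + 1), List.length_cons, Finset.sum_range_succ', List.getD_cons_zero]
    simp only [List.getD_cons_succ, Nat.add_zero]
    have : ∀ k, i + 1 + k = i + (k + 1) := fun k => by ring
    simp only [this]
    ring

/-- `u1Fold J i L 0 = Σ_{k < |L|} ⌈L_k/(J − (i+k) − 1)⌉` (no big term is ever unified against `zero_add`). [folklore] -/
theorem u1Fold_zero (J i : ℕ) (L : List ℕ) :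
    u1Fold J i L 0 = ∑ k ∈ Finset.range L.length, cdiv (L.getD k 0) (J - (i + k) - 1) := by
  rw [u1Fold_eq, zero_add]

/-- The `Φ⁺` list of generation `g ≥ 1` has length `K`. [folklore] -/
theorem tabRun_phiHi_length (J D K g : ℕ) (hg : 1 ≤ g) : (tabRun J D K g).phiHi.length = K := by
  obtain ⟨g', rfl⟩ : ∃ g', g = g' + 1 := ⟨g - 1, by omega⟩
  cases g' with
  | zero => exact (tabGen_length J D K K (List.replicate K 0) (List.replicate K 0) 0 0).2.1
  | succ g'' =>
    show (tabNext J D K (g'' + 2) (tabRun J D K (g'' + 1))).phiHi.length = K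
    unfold tabNext
    exact (tabGen_length J D K ((g'' + 2) * K) _ _ _ _).2.1

/-! ### One cell of `∫ Φ₆(x)/(1−x) dx` -/

/-- `Φ₆(x)/(1−x)` is interval integrable on `[a, b] ⊂ (−∞, 1)`. [folklore] -/
theorem phiSix_div_intervalIntegrable {a b : ℝ} (hab : a ≤ b) (hb : b < 1) :
    IntervalIntegrable (fun x => (∑ m ∈ Finset.Icc 1 6, (1 / (m.factorial : ℝ)) *
        cpow (fun t : ℝ => if (1651 / 10000 : ℝ) < t then 1 / t else 0) m x) * (1 / (1 - x))) volume a b := by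
  have hν : (0 : ℝ) < 1651 / 10000 := by norm_num
  have h1 : IntervalIntegrable (fun x => ∑ m ∈ Finset.Icc 1 6, (1 / (m.factorial : ℝ)) *
      cpow (fun t : ℝ => if (1651 / 10000 : ℝ) < t then 1 / t else 0) m x) volume a b := by
    rw [intervalIntegrable_iff_integrableOn_Ioc_of_le hab]
    exact (locBdd_buchstabPhi hν 6).integrableOn_Ioc a b
  refine h1.mul_continuousOn (continuousOn_const.div (continuousOn_const.sub continuousOn_id) fun x hx => ?_)
  rw [Set.uIcc_of_le hab] at hx
  have : x ≤ b := hx.2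
  intro h0
  linarith

/-- **One cell**: for `60000 ≤ i`, `i + 1 ≤ 100188`, if `Φ₆ ≤ F/D` on `(x_i, x_{i+1}]` then
`∫_{x_i}^{x_{i+1}} Φ₆(x)/(1−x) dx ≤ ⌈F/(J−i−1)⌉/D` (`J = 120000`, `D = 2⁴⁰`). [folklore] -/
theorem cell_integral_le {i F : ℕ} (hi2 : i + 1 ≤ 100188)
    (hF : ∀ x ∈ Set.Ioc ((i : ℝ) / tabJ) (((i : ℝ) + 1) / tabJ),
      ∑ m ∈ Finset.Icc 1 6, (1 / (m.factorial : ℝ)) *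
        cpow (fun t : ℝ => if (1651 / 10000 : ℝ) < t then 1 / t else 0) m x ≤ (F : ℝ) / tabD) :
    ∫ x in ((i : ℝ) / tabJ)..(((i : ℝ) + 1) / tabJ), (∑ m ∈ Finset.Icc 1 6, (1 / (m.factorial : ℝ)) *
        cpow (fun t : ℝ => if (1651 / 10000 : ℝ) < t then 1 / t else 0) m x) * (1 / (1 - x)) ≤
      ((cdiv F (tabJ - i - 1) : ℕ) : ℝ) / tabD := by
  have hν : (0 : ℝ) < 1651 / 10000 := by norm_num
  have hJ : (tabJ : ℝ) = 120000 := by norm_num [tabJ]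
  have hD : (0 : ℝ) < tabD := by norm_num [tabD]
  have hi2r : (i : ℝ) + 1 ≤ 100188 := by exact_mod_cast hi2
  have hab : (i : ℝ) / tabJ ≤ ((i : ℝ) + 1) / tabJ := by rw [hJ]; apply div_le_div_of_nonneg_right <;> linarith
  have hb1 : ((i : ℝ) + 1) / tabJ < 1 := by rw [hJ, div_lt_one (by norm_num)]; linarith
  have hgap : 0 < 1 - ((i : ℝ) + 1) / tabJ := by linarith
  -- pointwise bound on the open cell
  have hpt : ∀ x ∈ Set.Ioo ((i : ℝ) / tabJ) (((i : ℝ) + 1) / tabJ),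
      (∑ m ∈ Finset.Icc 1 6, (1 / (m.factorial : ℝ)) *
        cpow (fun t : ℝ => if (1651 / 10000 : ℝ) < t then 1 / t else 0) m x) * (1 / (1 - x)) ≤
        (F : ℝ) / tabD * (1 / (1 - ((i : ℝ) + 1) / tabJ)) := by
    intro x hx
    have hΦ := hF x ⟨hx.1, hx.2.le⟩
    have hΦ0 := buchstabPhi_nonneg hν.le 6 x
    have h1x : 0 < 1 - x := by linarith [hx.2]
    refine mul_le_mul hΦ ?_ (by positivity) (by positivity)
    exact one_div_le_one_div_of_le hgap (by linarith [hx.2])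
  calc ∫ x in ((i : ℝ) / tabJ)..(((i : ℝ) + 1) / tabJ), (∑ m ∈ Finset.Icc 1 6, (1 / (m.factorial : ℝ)) *
          cpow (fun t : ℝ => if (1651 / 10000 : ℝ) < t then 1 / t else 0) m x) * (1 / (1 - x))
      ≤ ∫ _ in ((i : ℝ) / tabJ)..(((i : ℝ) + 1) / tabJ), (F : ℝ) / tabD * (1 / (1 - ((i : ℝ) + 1) / tabJ)) :=
        intervalIntegral.integral_mono_on_of_le_Ioo hab (phiSix_div_intervalIntegrable hab hb1)
          intervalIntegrable_const hpt
    _ = (((i : ℝ) + 1) / tabJ - (i : ℝ) / tabJ) * ((F : ℝ) / tabD * (1 / (1 - ((i : ℝ) + 1) / tabJ))) := by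
        rw [intervalIntegral.integral_const, smul_eq_mul]
    _ = (F : ℝ) / (((tabJ - i - 1 : ℕ) : ℝ)) / tabD := by
        have hsub : ((tabJ - i - 1 : ℕ) : ℝ) = 119999 - i := by
          rw [Nat.cast_sub (by norm_num [tabJ]; omega), Nat.cast_sub (by norm_num [tabJ]; omega), hJ]
          push_cast; ring
        rw [hsub, hJ]
        have hne : (119999 : ℝ) - i ≠ 0 := by
          have : (i : ℝ) + 1 ≤ 100188 := hi2r
          intro h; linarith
        have hne2 : (120000 : ℝ) - (i + 1) ≠ 0 := by
          intro h; apply hne; linarith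
        rw [show (1 : ℝ) - ((i : ℝ) + 1) / 120000 = (119999 - i) / 120000 by ring, one_div_div]
        field_simp
        ring
    _ ≤ ((cdiv F (tabJ - i - 1) : ℕ) : ℝ) / tabD := by
        apply div_le_div_of_nonneg_right _ hD.le
        have hE : 0 < tabJ - i - 1 := by norm_num [tabJ]; omega
        have hEr : (0 : ℝ) < ((tabJ - i - 1 : ℕ) : ℝ) := by exact_mod_cast hE
        rw [div_le_iff₀ hEr]
        have h := le_mul_ceilDiv F hE
        calc (F : ℝ) ≤ (((tabJ - i - 1) * ((F + (tabJ - i - 1) - 1) / (tabJ - i - 1)) : ℕ) : ℝ) := by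
              exact_mod_cast h
          _ = ((cdiv F (tabJ - i - 1) : ℕ) : ℝ) * ((tabJ - i - 1 : ℕ) : ℝ) := by
              unfold cdiv; push_cast; ring

/-- **A run of `n` cells inside generation `g`** (positions `j₀ … j₀+n−1`, cells `i₀ … i₀+n−1`, `i₀ = gK + j₀`,
`i₀ + n ≤ 100188`): `∫_{x_{i₀}}^{x_{i₀+n}} Φ₆/(1−x) ≤ (Σ_{k<n} ⌈Φ⁺_{j₀+k}/(J−(i₀+k)−1)⌉)/D`. [folklore] -/
theorem gen_integral_le (g j₀ i₀ : ℕ) (hg1 : 1 ≤ g) (hg5 : g ≤ 5) (hi₀ : i₀ = g * tabK + j₀) :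
    ∀ n : ℕ, j₀ + n ≤ tabK → i₀ + n ≤ 100188 →
      ∫ x in ((i₀ : ℝ) / tabJ)..((((i₀ + n : ℕ) : ℝ)) / tabJ), (∑ m ∈ Finset.Icc 1 6, (1 / (m.factorial : ℝ)) *
          cpow (fun t : ℝ => if (1651 / 10000 : ℝ) < t then 1 / t else 0) m x) * (1 / (1 - x)) ≤
        (∑ k ∈ Finset.range n, ((cdiv ((tabRun tabJ tabD tabK g).phiHi.getD (j₀ + k) 0) (tabJ - (i₀ + k) - 1) : ℕ) : ℝ))
          / tabD := by
  intro n
  induction n with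
  | zero => intro _ _; simp
  | succ n ih =>
    intro hn hi
    have hJ : (tabJ : ℝ) = 120000 := by norm_num [tabJ]
    have ih' := ih (by omega) (by omega)
    -- split off the last cell
    have hcell := (tabRun_sound_phiSix g hg1 hg5).1 (j₀ + n) (by omega)
    have hidx : g * tabK + (j₀ + n) = i₀ + n := by rw [hi₀]; ring
    rw [hidx] at hcell
    have hc := cell_integral_le (i := i₀ + n) (F := (tabRun tabJ tabD tabK g).phiHi.getD (j₀ + n) 0)
      (by omega) (fun x hx => (hcell x (by exact_mod_cast hx)).2)
    have hint1 : IntervalIntegrable (fun x => (∑ m ∈ Finset.Icc 1 6, (1 / (m.factorial : ℝ)) *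
        cpow (fun t : ℝ => if (1651 / 10000 : ℝ) < t then 1 / t else 0) m x) * (1 / (1 - x))) volume
        ((i₀ : ℝ) / tabJ) ((((i₀ + n : ℕ) : ℝ)) / tabJ) :=
      phiSix_div_intervalIntegrable (by rw [hJ]; apply div_le_div_of_nonneg_right <;> [simp; norm_num])
        (by rw [hJ, div_lt_one (by norm_num)]; have : ((i₀ + n : ℕ) : ℝ) ≤ 100187 := by exact_mod_cast (by omega)
            linarith)
    have hint2 : IntervalIntegrable (fun x => (∑ m ∈ Finset.Icc 1 6, (1 / (m.factorial : ℝ)) *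
        cpow (fun t : ℝ => if (1651 / 10000 : ℝ) < t then 1 / t else 0) m x) * (1 / (1 - x))) volume
        ((((i₀ + n : ℕ) : ℝ)) / tabJ) ((((i₀ + n : ℕ) : ℝ) + 1) / tabJ) :=
      phiSix_div_intervalIntegrable (by rw [hJ]; apply div_le_div_of_nonneg_right <;> [simp; norm_num])
        (by rw [hJ, div_lt_one (by norm_num)]; have : ((i₀ + n : ℕ) : ℝ) ≤ 100187 := by exact_mod_cast (by omega)
            linarith)
    have hsplit := (intervalIntegral.integral_add_adjacent_intervals hint1 hint2).symm
    have hcast : (((i₀ + (n + 1) : ℕ) : ℝ)) / tabJ = (((i₀ + n : ℕ) : ℝ) + 1) / tabJ := by push_cast; ring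
    rw [hcast, hsplit, Finset.sum_range_succ]
    have hsplitD : ((∑ k ∈ Finset.range n, ((cdiv ((tabRun tabJ tabD tabK g).phiHi.getD (j₀ + k) 0)
          (tabJ - (i₀ + k) - 1) : ℕ) : ℝ)) +
        ((cdiv ((tabRun tabJ tabD tabK g).phiHi.getD (j₀ + n) 0) (tabJ - (i₀ + n) - 1) : ℕ) : ℝ)) / tabD =
        (∑ k ∈ Finset.range n, ((cdiv ((tabRun tabJ tabD tabK g).phiHi.getD (j₀ + k) 0)
          (tabJ - (i₀ + k) - 1) : ℕ) : ℝ)) / tabD +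
        ((cdiv ((tabRun tabJ tabD tabK g).phiHi.getD (j₀ + n) 0) (tabJ - (i₀ + n) - 1) : ℕ) : ℝ) / tabD :=
      add_div _ _ _
    rw [hsplitD]
    have hc' : ∫ x in ((((i₀ + n : ℕ) : ℝ)) / tabJ)..((((i₀ + n : ℕ) : ℝ) + 1) / tabJ),
        (∑ m ∈ Finset.Icc 1 6, (1 / (m.factorial : ℝ)) *
          cpow (fun t : ℝ => if (1651 / 10000 : ℝ) < t then 1 / t else 0) m x) * (1 / (1 - x)) ≤
        ((cdiv ((tabRun tabJ tabD tabK g).phiHi.getD (j₀ + n) 0) (tabJ - (i₀ + n) - 1) : ℕ) : ℝ) / tabD := by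
      exact hc
    exact add_le_add ih' hc'

/-! ### The `r = 1` pairing against `certU1` -/

/-- `certU1` as the three cell sums (ℕ). [folklore] -/
theorem certU1_eq_sums :
    certU1 =
      ∑ k ∈ Finset.range 19248, cdiv ((tabRun tabJ tabD tabK 3).phiHi.getD (564 + k) 0) (tabJ - (60000 + k) - 1) +
      ∑ k ∈ Finset.range 19812, cdiv ((tabRun tabJ tabD tabK 4).phiHi.getD k 0) (tabJ - (79248 + k) - 1) +
      ∑ k ∈ Finset.range 1128, cdiv ((tabRun tabJ tabD tabK 5).phiHi.getD k 0) (tabJ - (99060 + k) - 1) := by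
  have hL3 : (tabRun tabJ tabD tabK 3).phiHi.length = tabK := tabRun_phiHi_length _ _ _ 3 (by norm_num)
  have hL4 : (tabRun tabJ tabD tabK 4).phiHi.length = tabK := tabRun_phiHi_length _ _ _ 4 (by norm_num)
  have hL5 : (tabRun tabJ tabD tabK 5).phiHi.length = tabK := tabRun_phiHi_length _ _ _ 5 (by norm_num)
  have hK1 : Finset.range (tabK - 564) = Finset.range 19248 := by rw [show tabK - 564 = 19248 by norm_num [tabK]]
  have hK2 : Finset.range (min 1128 tabK) = Finset.range 1128 := by rw [show min 1128 tabK = 1128 by norm_num [tabK]]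
  have hK3 : Finset.range tabK = Finset.range 19812 := by rw [show tabK = 19812 from rfl]
  have hA : u1Fold tabJ 60000 ((tabRun tabJ tabD tabK 3).phiHi.drop 564) 0 =
      ∑ k ∈ Finset.range 19248, cdiv ((tabRun tabJ tabD tabK 3).phiHi.getD (564 + k) 0) (tabJ - (60000 + k) - 1) := by
    rw [u1Fold_zero, List.length_drop, hL3, hK1]
    refine Finset.sum_congr rfl fun k _ => ?_
    rw [List.getD_eq_getElem?_getD, List.getD_eq_getElem?_getD, List.getElem?_drop]
  have hB : u1Fold tabJ 79248 (tabRun tabJ tabD tabK 4).phiHi 0 =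
      ∑ k ∈ Finset.range 19812, cdiv ((tabRun tabJ tabD tabK 4).phiHi.getD k 0) (tabJ - (79248 + k) - 1) := by
    rw [u1Fold_zero, hL4, hK3]
  have hC : u1Fold tabJ 99060 ((tabRun tabJ tabD tabK 5).phiHi.take 1128) 0 =
      ∑ k ∈ Finset.range 1128, cdiv ((tabRun tabJ tabD tabK 5).phiHi.getD k 0) (tabJ - (99060 + k) - 1) := by
    rw [u1Fold_zero, List.length_take, hL5, hK2]
    refine Finset.sum_congr rfl fun k hk => ?_
    rw [Finset.mem_range] at hk
    rw [List.getD_eq_getElem?_getD, List.getD_eq_getElem?_getD, List.getElem?_take, if_pos hk]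
  unfold certU1
  rw [hA, hB, hC]

/-- **`D · ∫_{(ν₀,1/2]} Φ₆(1−t)/t dt ≤ certU1`.** [cite: FordMaynard2024PrimeSieves, Theorem 7.3 (a), §8.2] -/
theorem pairing_one_le_certU1 :
    ∫ t in Set.Ioc (1651 / 10000 : ℝ) (1 / 2), (∑ m ∈ Finset.Icc 1 6, (1 / (m.factorial : ℝ)) *
        cpow (fun t : ℝ => if (1651 / 10000 : ℝ) < t then 1 / t else 0) m (1 - t)) / t ≤
      ((certU1 : ℕ) : ℝ) / tabD := by
  have hJ : (tabJ : ℝ) = 120000 := by norm_num [tabJ]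
  set f : ℝ → ℝ := fun x => (∑ m ∈ Finset.Icc 1 6, (1 / (m.factorial : ℝ)) *
    cpow (fun t : ℝ => if (1651 / 10000 : ℝ) < t then 1 / t else 0) m x) * (1 / (1 - x)) with hf
  -- reflect `t ↦ 1 − t`
  have hrefl : ∫ t in Set.Ioc (1651 / 10000 : ℝ) (1 / 2), (∑ m ∈ Finset.Icc 1 6, (1 / (m.factorial : ℝ)) *
        cpow (fun t : ℝ => if (1651 / 10000 : ℝ) < t then 1 / t else 0) m (1 - t)) / t =
      ∫ x in ((60000 : ℕ) : ℝ) / tabJ..((100188 : ℕ) : ℝ) / tabJ, f x := by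
    rw [← intervalIntegral.integral_of_le (by norm_num : (1651 / 10000 : ℝ) ≤ 1 / 2)]
    have h1 : (fun t => (∑ m ∈ Finset.Icc 1 6, (1 / (m.factorial : ℝ)) *
        cpow (fun t : ℝ => if (1651 / 10000 : ℝ) < t then 1 / t else 0) m (1 - t)) / t) = fun t => f (1 - t) := by
      funext t; simp only [hf, sub_sub_cancel]; ring
    rw [h1, intervalIntegral.integral_comp_sub_left (fun x => f x) 1, hJ]
    norm_num
  rw [hrefl]
  -- the three runs
  have e1 := gen_integral_le 3 564 60000 (by norm_num) (by norm_num) (by norm_num [tabK]) 19248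
    (by norm_num [tabK]) (by norm_num)
  have e2 := gen_integral_le 4 0 79248 (by norm_num) (by norm_num) (by norm_num [tabK]) 19812
    (by norm_num [tabK]) (by norm_num)
  have e3 := gen_integral_le 5 0 99060 (by norm_num) (by norm_num) (by norm_num [tabK]) 1128
    (by norm_num [tabK]) (by norm_num)
  have hi1 : IntervalIntegrable f volume (((60000 : ℕ) : ℝ) / tabJ) (((60000 + 19248 : ℕ) : ℝ) / tabJ) :=
    phiSix_div_intervalIntegrable (by rw [hJ]; norm_num) (by rw [hJ]; norm_num)
  have hi2 : IntervalIntegrable f volume (((79248 : ℕ) : ℝ) / tabJ) (((79248 + 19812 : ℕ) : ℝ) / tabJ) :=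
    phiSix_div_intervalIntegrable (by rw [hJ]; norm_num) (by rw [hJ]; norm_num)
  have hi3 : IntervalIntegrable f volume (((99060 : ℕ) : ℝ) / tabJ) (((99060 + 1128 : ℕ) : ℝ) / tabJ) :=
    phiSix_div_intervalIntegrable (by rw [hJ]; norm_num) (by rw [hJ]; norm_num)
  have hb1 : (((60000 + 19248 : ℕ) : ℝ)) / tabJ = ((79248 : ℕ) : ℝ) / tabJ := by norm_num
  have hb2 : (((79248 + 19812 : ℕ) : ℝ)) / tabJ = ((99060 : ℕ) : ℝ) / tabJ := by norm_num
  have hb3 : (((99060 + 1128 : ℕ) : ℝ)) / tabJ = ((100188 : ℕ) : ℝ) / tabJ := by norm_num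
  rw [hb1] at e1 hi1
  rw [hb2] at e2 hi2
  rw [hb3] at e3 hi3
  rw [← intervalIntegral.integral_add_adjacent_intervals (hi1.trans hi2) hi3,
    ← intervalIntegral.integral_add_adjacent_intervals hi1 hi2]
  have hU : ((certU1 : ℕ) : ℝ) / tabD =
      (∑ k ∈ Finset.range 19248, ((cdiv ((tabRun tabJ tabD tabK 3).phiHi.getD (564 + k) 0)
          (tabJ - (60000 + k) - 1) : ℕ) : ℝ)) / tabD +
      (∑ k ∈ Finset.range 19812, ((cdiv ((tabRun tabJ tabD tabK 4).phiHi.getD k 0)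
          (tabJ - (79248 + k) - 1) : ℕ) : ℝ)) / tabD +
      (∑ k ∈ Finset.range 1128, ((cdiv ((tabRun tabJ tabD tabK 5).phiHi.getD k 0)
          (tabJ - (99060 + k) - 1) : ℕ) : ℝ)) / tabD := by
    rw [← add_div, ← add_div, certU1_eq_sums]
    push_cast
    ring
  rw [hU]
  simp only [zero_add] at e2 e3
  exact add_le_add (add_le_add e1 e2) e3

end Summit.Parity.GeneralizedHardyLittlewood.FordMaynardSieveConst01651SieveConst01651

end
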